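import Literature.NumberTheory.GaloisCohomology.Howard2004.UnramifiedSelfOrthogonal
import Literature.NumberTheory.GaloisRepresentations.ContinuousH2JointInjective
import HarnessLib

/-!
# Howard 2004, H.4: the readout predicate `LocalTwoDetects` from a dualizing family of the level ring

Topic `NumberTheory/GaloisCohomology/Howard2004` (sequel to `UnramifiedSelfOrthogonal`; one definition with body
(`DualityDatum.lamMul`, the character `λ(r ·)`) and theorems; no named fact, no instance, no notation, no `sorry`).

`DualityDatum.isSelfOrthogonalAt_of_unramified` (Howard's H.4 at an unramified place, from Milne I Thm. 2.6 for a family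
of local invariant maps) takes the readout predicate `D.LocalTwoDetects exp hexp v`: the `μ_{p^k}`-valued characters
`exp ∘ λ'` of `R(1)` jointly detect `H²(K_v, R(1))`.  Here it is DERIVED from a finite dualizing family `(r_i)_{i ∈ ι}` of the
level ring — `x ↦ (exp (λ (r_i x)))_i : R → Π_i μ_{p^k}` bijective, i.e. `R(1) ≅ Π_i μ_{p^k}` through the characters
`exp ∘ λ_{r_i}` — by the tree's `twoCohomology_eq_zero_of_forall_cohomologyMap_eq_zero` («`H²` commutes with finite
products of coefficient modules», Brown III §6).  For `R = A_{m,k} = Λ/(T^m + p, p^k)` and `λ` the tail form such a family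
is the dual family of `[T^i]` (`EisensteinCoeff.dualFamily`, `tailFormZMod_dualFamily_mul_mk_X_pow`).
BSD is not proved by any of this.

References: [Howard2004HeegnerKolyvagin] B. Howard, Compositio Math. 140 (2004), §1.3 H.4 (arXiv:1202.6340 p. 7 L69–82);
[Brown1982CohomologyGroups] K. S. Brown, *Cohomology of Groups* (1982), III §6.
-/

noncomputable section

open CategoryTheory Function NumberField IsDedekindDomain Field
open scoped ContRepresentation NumberField

namespace Literature.NumberTheory.GaloisCohomology.Howard2004

open Literature.NumberTheory.GaloisRepresentations
open Literature.NumberTheory.GaloisRepresentations.DiscreteGaloisModule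

section Characters

variable {R : Type} [CommRing R] {n : ℕ}

/-- The character `λ_r = λ(r ·)` of the level ring. [cite: Howard2004HeegnerKolyvagin, §1.3 H.4 (arXiv p. 7, L78–82)] -/
def DualityDatum.lamMul (lam : R →+ ZMod n) (r : R) : R →+ ZMod n :=
  lam.comp (AddMonoidHom.mulLeft r)

/-- Unfolding: `λ_r r' = λ (r r')`. [cite: Howard2004HeegnerKolyvagin, §1.3 H.4 (arXiv p. 7, L78–82)] -/
@[simp]
theorem DualityDatum.lamMul_apply (lam : R →+ ZMod n) (r r' : R) : DualityDatum.lamMul lam r r' = lam (r * r') := rfl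

/-- `λ_r` is again `ℤ_p`-semilinear if `λ` is. [cite: Howard2004HeegnerKolyvagin, §1.3 H.4 (arXiv p. 7, L78–82)] -/
theorem DualityDatum.lamMul_semilinear {p : ℕ} [Fact p.Prime] [Algebra ℤ_[p] R] {k : ℕ} (lam : R →+ ZMod (p ^ k))
    (hlam : ∀ (z : ℤ_[p]) (r : R), lam (algebraMap ℤ_[p] R z * r) = PadicInt.toZModPow k z * lam r) (r : R)
    (z : ℤ_[p]) (r' : R) :
    DualityDatum.lamMul lam r (algebraMap ℤ_[p] R z * r') = PadicInt.toZModPow k z * DualityDatum.lamMul lam r r' := by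
  rw [DualityDatum.lamMul_apply, DualityDatum.lamMul_apply, mul_left_comm, hlam]

end Characters

variable {K : Type} [Field K] [NumberField K] {M : Type} [AddCommGroup M] [TopologicalSpace M]
  [DiscreteTopology M] {R : Type} [CommRing R] [Module R M] [TopologicalSpace R] [DiscreteTopology R]
  {p : ℕ} [Fact p.Prime] [Algebra ℤ_[p] R] {cd : ConjugationDatum K} {ρ : DiscreteGaloisModule K M}
  (D : DualityDatum p cd ρ R) {k : ℕ}
  (lam : R →+ ZMod (p ^ k))
  (hlam : ∀ (z : ℤ_[p]) (r : R), lam (algebraMap ℤ_[p] R z * r) = PadicInt.toZModPow k z * lam r)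
  (exp : ZMod (p ^ k) →+ MuCarrier K (p ^ k))
  (hexp : ∀ (g : absoluteGaloisGroup K) (x : ZMod (p ^ k)),
    exp (cyclotomicCharacterModPow K p k g * x) = mu K (p ^ k) g (exp x))

namespace DualityDatum

/-- **The `μ_{p^k}`-valued characters of `R(1)` detect `H²(K_v, R(1))` at the place `v`**: a class
`z ∈ H²(K_v, R(1))` with `H²(exp ∘ λ') z = 0` for every `ℤ_p`-semilinear `λ' : R → ℤ/p^k` is zero — the readout hypothesis
`hdet` of `DualityDatum.isSelfOrthogonalAt_of_unramified`.  (For `R` free over `ℤ/p^k` with a dualizing form this is the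
readout `H²(K_v, R(1)) ≅ Π_i H²(K_v, μ_{p^k})`, `localTwoDetects_of_bijective`.)
[cite: Howard2004HeegnerKolyvagin, §1.3 H.4 (arXiv p. 7, L78–82: «induced local pairing … → R»)] -/
def LocalTwoDetects (_D : DualityDatum p cd ρ R) (exp : ZMod (p ^ k) →+ MuCarrier K (p ^ k))
    (hexp : ∀ (g : absoluteGaloisGroup K) (x : ZMod (p ^ k)),
      exp (cyclotomicCharacterModPow K p k g * x) = mu K (p ^ k) g (exp x))
    (v : Place K) : Prop :=
  ∀ z : galoisCohomology (_D.twistOne.toLocal v) 2,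
    (∀ (lam' : R →+ ZMod (p ^ k))
        (hlam' : ∀ (z : ℤ_[p]) (r : R), lam' (algebraMap ℤ_[p] R z * r) = PadicInt.toZModPow k z * lam' r),
        cohomologyMap (_D.expLamLocalHom lam' hlam' exp hexp v) 2 z = 0) →
      z = 0

include hlam in
/-- **The readout predicate from a dualizing family.**  If for a finite family `(r_i)` of elements of `R` the map
`x ↦ (exp (λ (r_i x)))_i : R → Π_i μ_{p^k}` is bijective (i.e. `R(1) ≅ Π_i μ_{p^k}` as groups through the characters
`exp ∘ λ_{r_i}`), then the characters detect `H²(K_v, R(1))` (`twoCohomology_eq_zero_of_forall_cohomologyMap_eq_zero`).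
[cite: Howard2004HeegnerKolyvagin, §1.3 H.4 (arXiv p. 7, L78–82)] [cite: Brown1982CohomologyGroups, III §6] -/
theorem localTwoDetects_of_bijective {ι : Type} [Finite ι] (r : ι → R)
    (hbij : Bijective fun x : R => fun i : ι => exp (lam (r i * x))) (v : Place K) :
    D.LocalTwoDetects exp hexp v := by
  intro z hz
  haveI : CompactSpace (absoluteGaloisGroup (Place.Completion v)) := absoluteGaloisGroup_compactSpace _
  -- the family of characters `exp ∘ λ_{r_i}` and the inverse of `x ↦ (exp λ(r_i x))_i`
  let π : ∀ i : ι, (D.twistOne.toLocal v).toTopRep ⟶ ((mu K (p ^ k)).toLocal v).toTopRep := fun i =>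
    D.expLamLocalHom (lamMul lam (r i)) (lamMul_semilinear lam hlam (r i)) exp hexp v
  let e : R ≃ (ι → MuCarrier K (p ^ k)) := Equiv.ofBijective _ hbij
  have hπ : ∀ (x : R) (i : ι), (π i).hom x = e x i := fun x i => rfl
  refine twoCohomology_eq_zero_of_forall_cohomologyMap_eq_zero π (fun y => e.symm y)
    continuous_of_discreteTopology (fun y i => ?_) (fun x => ?_) z fun i => hz _ _
  · change e (e.symm y) i = y i
    rw [Equiv.apply_symm_apply]
  · change e.symm (fun i => e x i) = x
    exact e.symm_apply_apply x

/-- **H.4 at an unramified place from a dualizing family** (`isSelfOrthogonalAt_of_unramified_of_isPerfect` with the readout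
hypothesis discharged by `localTwoDetects_of_bijective`). [cite: Howard2004HeegnerKolyvagin, §1.3 H.4 (arXiv p. 7, L69–82)]
[cite: MilneADT2006, Ch. I, Cor. 2.3 and Thm. 2.6] -/
theorem isSelfOrthogonalAt_of_unramified_of_bijective [Finite M] (hM : ∀ m : M, (p ^ k) • m = 0)
    (inv : LocalInvariants K (p ^ k)) (hperf : inv.IsPerfect) (hUO : inv.UnramifiedOrthogonal)
    (v : HeightOneSpectrum (𝓞 K)) (hv : ((p : ℕ) : 𝓞 K) ∉ v.asIdeal) (hur : GaloisRep.IsUnramifiedAt v ρ)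
    (hΘ : Bijective (D.toTateDual lam hlam exp hexp)) {ι : Type} [Finite ι] (r : ι → R)
    (hbij : Bijective fun x : R => fun i : ι => exp (lam (r i * x)))
    (𝓕 : SelmerStructure ρ) (h𝓕 : 𝓕 (Sum.inr v) = unramifiedSubgroup (GaloisRep.toLocal v ρ) 1)
    (hFbar : (𝓕 (Sum.inr (cd.σ • v))).map (cd.transportH1 ρ v) =
      unramifiedSubgroup (GaloisRep.toLocal v (cd.twist ρ)) 1) :
    D.IsSelfOrthogonalAt 𝓕 v :=
  D.isSelfOrthogonalAt_of_unramified_of_isPerfect lam hlam exp hexp hM inv hperf hUO v hv hur hΘ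
    (D.localTwoDetects_of_bijective lam hlam exp hexp r hbij (Sum.inr v)) 𝓕 h𝓕 hFbar

end DualityDatum

end Literature.NumberTheory.GaloisCohomology.Howard2004
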